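import Summits.BirchSwinnertonDyer.BirchSwinnertonDyer.Theorems.SignedLowerHalvesSmallImageLowerHalfBothSignsRttD2SeqSemilocCoindAnn
import Summits.BirchSwinnertonDyer.BirchSwinnertonDyer.Theorems.SignedLowerHalvesSmallImageLowerHalfBothSignsRttD2SeqSemilocFrobQuot
import Summits.BirchSwinnertonDyer.BirchSwinnertonDyer.Theorems.SignedLowerHalvesSmallImageLowerHalfBothSignsRttJunctionFrobenius
import HarnessLib

/-!
# Route `SignedLowerHalves`, crux L `SmallImageLowerHalfBothSigns` (stmt-BirchSwinnertonDyer-23599), line `rtt_w3` v32 — stub S3β″ (`stub_junctionPT_ns`), input N5-(iii)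
# (unramified generator), component C5 (Frobenius quotient): `Ann_{Λ_𝒪}([δ_1 ⊗ (1⊗ζ₀)] ∈ Maps(Γ_K ⧸ U_n, X_k) / (φ − 1)) = (p^k, ω_n, P_w)`, `P_w = (1+T)^{x} − C(θ′(φ)χ(φ))`

WIDTH seat `bsd-line-slh-p3-w3` g27 under LEAD `cruxlead-stmt-BirchSwinnertonDyer-23599` g14 (cell `bsd-ssimc`); helper `--supports stmt-BirchSwinnertonDyer-23599`
(plan `Lines/rtt_w3-DESIGN-N5iii-w3-g26.md` §2 C5). ONE DEFINITION WITH BODY (`coindFrob`, the action of `g ∈ Γ_K` on `Maps(Γ_K ⧸ U_n, X_k)` as a `Λ_𝒪`-LINEAR endomorphism) + THEOREMS;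
no named fact, no instance, no `sorry`. HONEST FRAMING: finite-level algebra. The action of `g ∈ Γ_K` on the coinduced coefficients commutes with the `𝒪`-scalars and with `R_γ`, hence
(Kaplansky §19 (a)) is `Λ_𝒪`-linear; on the generator, `g ⋆ (δ_1 ⊗ (1⊗ζ₀)) = δ_{[g]} ⊗ (u ⊗ ζ₀) = (C u · (1+T)^{pⁿ − x̄}) • b₀` with `u = θ′(g)χ_cyc(g)` (honda `muTwistO_eq_oMuScalar`) and
`[g] = [γ^{x̄}]` (`γ^{x̄} g⁻¹ ∈ U_n`); g26's abstract quotient lemma (`smul_mkQ_range_sub_eq_zero_iff`, p818694) and g27's cyclicity/exact annihilator (`…SemilocCoindModule`/`…SemilocCoindAnn`)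
give `Ann([b₀]) = (p^k, ω_n) + (C u (1+T)^{pⁿ−x̄} − 1) = (p^k, ω_n) + (P_w)` since `(1+T)^x ≡ (1+T)^{x̄} (mod ω_n)`. Nothing about S3β″, crux L or BSD is proved; all remain OPEN and are
proved for NO curve.
References: [SerreLocalFields1979] VII §5, XIII §1; [Lang1990] Ch. 5 §1; [Washington1997] §13.2; [JohnsonLeungKings2011] §4.2, §5.1.
-/

set_option autoImplicit false
set_option linter.dupNamespace false -- D-0017: single-problem summit, the namespace repeats the problem name by design
noncomputable section

open scoped Classical PowerSeries
open NumberField IsDedekindDomain Field CategoryTheory Function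

namespace Summit.BirchSwinnertonDyer.BirchSwinnertonDyer.Theorems.SmallImageRttD2Seq

open Literature.NumberTheory.EllipticCurves Literature.NumberTheory.GaloisRepresentations
  Literature.NumberTheory.GaloisRepresentations.DiscreteGaloisModule
  Literature.NumberTheory.ComplexMultiplication.EllipticUnits Literature.NumberTheory.ComplexMultiplication.EllipticUnits.JohnsonLeungKings2011
  Literature.Algebra.Module.LocallyNilpotent
  Summit.BirchSwinnertonDyer.BirchSwinnertonDyer.Theorems.SmallImageRttD2J1

section Frob

variable {K : Type} [Field K] [NumberField K] {p : ℕ} [Fact p.Prime] (S : Set (PadicAlgCl p)) (κ : ZpExtension K p) (γ : absoluteGaloisGroup K)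
  (θ' : absoluteGaloisGroup K →ₜ* (padicCoeffIntegers S)ˣ) (P : Set (HeightOneSpectrum (𝓞 K)))

/-! ## §1. Pure algebra: `J ⊔ (a) = J ⊔ (b)` when `a ≡ unit · b (mod J)` -/

/-- `J ⊔ (a) = J ⊔ (b)` when `a − w b ∈ J` for a unit `w`. [folklore] -/
theorem sup_span_singleton_eq_of_sub_mul_mem {R : Type*} [CommRing R] (J : Ideal R) {a b w : R} (hw : IsUnit w) (h : a - w * b ∈ J) :
    J ⊔ Ideal.span {a} = J ⊔ Ideal.span {b} := by
  apply le_antisymm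
  · refine sup_le le_sup_left ((Ideal.span_singleton_le_iff_mem _).mpr ?_)
    have : a = (a - w * b) + w * b := by ring
    rw [this]
    exact Submodule.add_mem_sup h (Ideal.mul_mem_left _ _ (Ideal.mem_span_singleton_self b))
  · refine sup_le le_sup_left ((Ideal.span_singleton_le_iff_mem _).mpr ?_)
    obtain ⟨wu, rfl⟩ := hw
    have h1 : (wu : R) * b ∈ J ⊔ Ideal.span {a} := by
      have e : (wu : R) * b = -(a - wu * b) + a := by ring
      rw [e]
      exact Submodule.add_mem_sup (J.neg_mem h) (Ideal.mem_span_singleton_self a)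
    have h2 := Ideal.mul_mem_left _ ((wu⁻¹ : Rˣ) : R) h1
    rwa [Units.inv_mul_cancel_left] at h2

/-- **`(p^k, ω_n) + (C u (1+T)^j − 1) = (p^k, ω_n) + ((1+T)^x − C u)`** when `j + (x mod pⁿ) = pⁿ`: `(1+T)^x ≡ (1+T)^{x mod pⁿ}` and `(1+T)^{pⁿ} ≡ 1 (mod ω_n)`.
[cite: Lang1990, Ch. 5 §1] [cite: Washington1997, §13.2] -/
theorem sup_span_C_mul_pow_sub_one_eq (n k j : ℕ) (x : ℤ_[p]) (hj : j + (PadicInt.toZModPow n x).val = p ^ n) (u : (padicCoeffIntegers S)ˣ) :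
    Ideal.span {PowerSeries.C (((p : ℕ) : padicCoeffIntegers S) ^ k), omegaT S n} ⊔
        Ideal.span {PowerSeries.C ((u : (padicCoeffIntegers S)ˣ) : padicCoeffIntegers S) * (1 + PowerSeries.X : IwasawaAlgebraO S) ^ j - 1} =
      Ideal.span {PowerSeries.C (((p : ℕ) : padicCoeffIntegers S) ^ k), omegaT S n} ⊔
        Ideal.span {iwasawaToIwasawaO S (PowerSeries.binomialSeries ℤ_[p] x) - PowerSeries.C ((u : (padicCoeffIntegers S)ˣ) : padicCoeffIntegers S)} := by
  obtain ⟨q, hq⟩ := exists_binomialSeries_sub_one_add_X_pow_val_eq n x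
  have hX : iwasawaToIwasawaO S (PowerSeries.X : PowerSeries ℤ_[p]) = PowerSeries.X := PowerSeries.map_X _
  have hι : iwasawaToIwasawaO S (PowerSeries.binomialSeries ℤ_[p] x) = (1 + PowerSeries.X : IwasawaAlgebraO S) ^ (PadicInt.toZModPow n x).val + omegaT S n * iwasawaToIwasawaO S q := by
    rw [sub_eq_iff_eq_add'] at hq
    rw [hq]
    simp only [map_add, map_mul, map_pow, map_sub, map_one, hX]
  refine sup_span_singleton_eq_of_sub_mul_mem _ (w := -(1 + PowerSeries.X : IwasawaAlgebraO S) ^ j) ?_ ?_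
  · exact (((PowerSeries.isUnit_iff_constantCoeff).mpr (by simp)).pow j).neg
  · have hmem : omegaT S n ∈ Ideal.span {PowerSeries.C (((p : ℕ) : padicCoeffIntegers S) ^ k), omegaT S n} := Ideal.subset_span (by simp)
    have e : PowerSeries.C ((u : (padicCoeffIntegers S)ˣ) : padicCoeffIntegers S) * (1 + PowerSeries.X : IwasawaAlgebraO S) ^ j - 1 -
        -(1 + PowerSeries.X : IwasawaAlgebraO S) ^ j * (iwasawaToIwasawaO S (PowerSeries.binomialSeries ℤ_[p] x) - PowerSeries.C ((u : (padicCoeffIntegers S)ˣ) : padicCoeffIntegers S)) =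
        omegaT S n * (1 + (1 + PowerSeries.X : IwasawaAlgebraO S) ^ j * iwasawaToIwasawaO S q) := by
      rw [hι, omegaT]
      have hpow : (1 + PowerSeries.X : IwasawaAlgebraO S) ^ j * (1 + PowerSeries.X : IwasawaAlgebraO S) ^ (PadicInt.toZModPow n x).val = (1 + PowerSeries.X) ^ p ^ n := by
        rw [← pow_add, hj]
      linear_combination hpow
    rw [e]
    exact Ideal.mul_mem_right _ _ hmem

/-! ## §2. The action of `g ∈ Γ_K` on `Maps(Γ_K ⧸ U_n, X_k)` as a `Λ_𝒪`-linear endomorphism -/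

/-- **The action of `g ∈ Γ_K` on `Maps(Γ_K ⧸ U_n, X_k)`** — `(g ⋆ f)(y) = g • f(g⁻¹ y)` — as a `Λ_𝒪`-LINEAR endomorphism: it commutes with the `𝒪`-scalars and with `R_γ` (both are
`Γ_K`-equivariant), hence with the whole forced `Λ_𝒪`-action (Kaplansky §19 (a)). [cite: Kaplansky1954, §19] [cite: SerreLocalFields1979, VII §5] -/
def coindFrob (n k : ℕ) (g : absoluteGaloisGroup K) :
    letI := coindModuleΛ S κ γ θ' P n k
    coindFin.{0, 0} (coeffRepK S θ' P k).toTopRep (κ.layerSubgroup n) →ₗ[IwasawaAlgebraO S] coindFin.{0, 0} (coeffRepK S θ' P k).toTopRep (κ.layerSubgroup n) := by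
  letI := coindModuleO S κ θ' P n k
  letI := coindModuleΛ S κ γ θ' P n k
  let L : coindFin.{0, 0} (coeffRepK S θ' P k).toTopRep (κ.layerSubgroup n) →ₗ[padicCoeffIntegers S] coindFin.{0, 0} (coeffRepK S θ' P k).toTopRep (κ.layerSubgroup n) :=
    { toFun := fun f ↦ (coindFin.{0, 0} (coeffRepK S θ' P k).toTopRep (κ.layerSubgroup n)).ρ g f
      map_add' := fun f f' ↦ map_add _ f f'
      map_smul' := fun a f ↦ by
        change (coindFin.{0, 0} (coeffRepK S θ' P k).toTopRep (κ.layerSubgroup n)).ρ g (coindScalar S κ θ' P n k a f) =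
          coindScalar S κ θ' P n k a ((coindFin.{0, 0} (coeffRepK S θ' P k).toTopRep (κ.layerSubgroup n)).ρ g f)
        exact (TopRep.hom_comm_apply (coindFinMap (coeffHomK S θ' P (oMuScalar S (p ^ k) a) (oMuScalar_muTwistO S θ' k a)) (κ.layerSubgroup n)) g f).symm }
  exact
    { toFun := L
      map_add' := map_add L
      map_smul' := fun r f ↦ map_smul_of_comp_eq (coindModuleΛ_spec S κ γ θ' P n k).1 (coindModuleΛ_spec S κ γ θ' P n k).2
        (coindModuleΛ_spec S κ γ θ' P n k).1 (coindModuleΛ_spec S κ γ θ' P n k).2 (coindPsi_locallyNilpotent S κ γ θ' P n k) L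
        (fun f ↦ by
          change (coindFin.{0, 0} (coeffRepK S θ' P k).toTopRep (κ.layerSubgroup n)).ρ g (coindR S κ θ' P n k γ f - f) =
            coindR S κ θ' P n k γ ((coindFin.{0, 0} (coeffRepK S θ' P k).toTopRep (κ.layerSubgroup n)).ρ g f) - (coindFin.{0, 0} (coeffRepK S θ' P k).toTopRep (κ.layerSubgroup n)).ρ g f
          rw [map_sub]
          exact congrArg (· - _) (TopRep.hom_comm_apply (rTransHom (coeffRepK S θ' P k).toTopRep (κ.layerSubgroup n) (γ : absoluteGaloisGroup K ⧸ κ.layerSubgroup n)) g f).symm)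
        r f }

omit [NumberField K] in
/-- Unfolding `coindFrob`: the coinduced action. [folklore] -/
theorem coindFrob_apply (n k : ℕ) (g : absoluteGaloisGroup K) (f : coindFin.{0, 0} (coeffRepK S θ' P k).toTopRep (κ.layerSubgroup n)) :
    (letI := coindModuleΛ S κ γ θ' P n k; coindFrob S κ γ θ' P n k g f) = (coindFin.{0, 0} (coeffRepK S θ' P k).toTopRep (κ.layerSubgroup n)).ρ g f :=
  rfl

omit [NumberField K] in
/-- **`g ⋆ (δ_1 ⊗ ξ) = δ_{[g]} ⊗ gξ`.** [cite: SerreLocalFields1979, VII §6] -/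
theorem coindFrob_single_one (n k : ℕ) (g : absoluteGaloisGroup K) (ξ : (coeffRepK S θ' P k).toTopRep) :
    (letI := coindModuleΛ S κ γ θ' P n k; coindFrob S κ γ θ' P n k g (coindSingle S κ θ' P n k 1 ξ)) =
      coindSingle S κ θ' P n k (g : absoluteGaloisGroup K ⧸ κ.layerSubgroup n) (coeffRepK S θ' P k g ξ) := by
  rw [coindFrob_apply]
  refine funext fun y ↦ ?_
  rw [coindFin_ρ_apply]
  by_cases hy : y = (g : absoluteGaloisGroup K ⧸ κ.layerSubgroup n)
  · subst hy
    rw [coindSingle_apply_self, show g⁻¹ • (g : absoluteGaloisGroup K ⧸ κ.layerSubgroup n) = 1 by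
      rw [MulAction.Quotient.smul_mk, smul_eq_mul, inv_mul_cancel, QuotientGroup.mk_one], coindSingle_apply_self]
    rfl
  · rw [coindSingle_apply_of_ne S κ θ' P n k hy, coindSingle_apply_of_ne, map_zero]
    intro h
    apply hy
    rw [inv_smul_eq_iff] at h
    rw [h, ← QuotientGroup.mk_one, MulAction.Quotient.smul_mk, smul_eq_mul, mul_one]

/-! ## §3. The generator under the Frobenius and the annihilator in the Frobenius quotient -/

omit [NumberField K] in
/-- `[γ^j]⁻¹ = [g]` in `Γ_K ⧸ U_n` when `γ^{x̄} g⁻¹ ∈ U_n` and `j + x̄ = pⁿ`. [cite: Washington1997, §13.1] -/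
theorem mk_pow_inv_eq_mk (n j : ℕ) {xb : ℕ} (hj : j + xb = p ^ n) {g : absoluteGaloisGroup K} (hx : γ ^ xb * g⁻¹ ∈ κ.layerSubgroup n) :
    (((γ ^ j : absoluteGaloisGroup K) : absoluteGaloisGroup K ⧸ κ.layerSubgroup n))⁻¹ = (g : absoluteGaloisGroup K ⧸ κ.layerSubgroup n) := by
  have hg : ((γ ^ xb : absoluteGaloisGroup K) : absoluteGaloisGroup K ⧸ κ.layerSubgroup n) = (g : absoluteGaloisGroup K ⧸ κ.layerSubgroup n) := by
    rw [QuotientGroup.eq]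
    have h := (κ.layerSubgroup_normal n).conj_mem _ (Subgroup.inv_mem _ hx) (γ ^ xb)⁻¹
    simpa only [mul_inv_rev, inv_inv, ← mul_assoc, inv_mul_cancel, one_mul, inv_mul_cancel_right] using h
  have hpn : ((γ ^ p ^ n : absoluteGaloisGroup K) : absoluteGaloisGroup K ⧸ κ.layerSubgroup n) = 1 := by
    rw [QuotientGroup.eq_one_iff, ← κ.index_layerSubgroup n]
    exact Subgroup.pow_index_mem (κ.layerSubgroup n) γ
  rw [← hg, inv_eq_iff_mul_eq_one, ← QuotientGroup.mk_mul, ← pow_add, hj, hpn]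

/-- ★ **The Frobenius on the generator: `g ⋆ (δ_1 ⊗ (1⊗ζ₀)) = (C u · (1+T)^{pⁿ−x̄}) • (δ_1 ⊗ (1⊗ζ₀))`**, `u = θ′(g)·χ_cyc(g)`, when `γ^{x̄} g⁻¹ ∈ U_n` (`x̄ = x mod pⁿ`): `g` moves
the support to `[g] = [γ^{x̄}] = [γ^{pⁿ−x̄}]⁻¹` and acts on `𝒪 ⊗ μ_{p^k} ⊗ θ′` as the scalar `u` (honda `muTwistO_eq_oMuScalar`). [cite: SerreLocalFields1979, VII §5–§6] [cite: JohnsonLeungKings2011, §4.2, §5.1] -/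
theorem coindFrob_single_one_eq_smul (n k : ℕ) (hθN : ∀ g ∈ ramificationSubgroup K P, θ' g = 1)
    (hμN : ∀ g ∈ ramificationSubgroup K P, ∀ ζ : MuCarrier K (p ^ k), mu K (p ^ k) g ζ = ζ) (ζ₀ : MuCarrier K (p ^ k))
    {g : absoluteGaloisGroup K} {x : ℤ_[p]} (hx : γ ^ (PadicInt.toZModPow n x).val * g⁻¹ ∈ κ.layerSubgroup n) :
    (letI := coindModuleΛ S κ γ θ' P n k;
      coindFrob S κ γ θ' P n k g (coindSingle S κ θ' P n k 1 ⟨OMuCarrier.tmul 1 ζ₀, mem_invariants_muTwistO_of_forall S θ' P k hθN hμN _⟩)) =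
      (letI := coindModuleΛ S κ γ θ' P n k;
        (PowerSeries.C (((θ' g : (padicCoeffIntegers S)ˣ) : padicCoeffIntegers S) * padicIntToCoeffIntegers S ((GaloisRep.cyclotomicCharacter K p g : ℤ_[p]ˣ) : ℤ_[p])) *
            (1 + PowerSeries.X : IwasawaAlgebraO S) ^ (p ^ n - (PadicInt.toZModPow n x).val)) •
          coindSingle S κ θ' P n k 1 ⟨OMuCarrier.tmul 1 ζ₀, mem_invariants_muTwistO_of_forall S θ' P k hθN hμN _⟩) := by
  haveI : NeZero (p ^ n) := ⟨pow_ne_zero _ (Fact.out : p.Prime).ne_zero⟩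
  have hj : (p ^ n - (PadicInt.toZModPow n x).val) + (PadicInt.toZModPow n x).val = p ^ n := Nat.sub_add_cancel (ZMod.val_lt _).le
  rw [coindFrob_single_one, C_mul_one_add_X_pow_smul_single_one, mk_pow_inv_eq_mk κ γ n _ hj hx]
  congr 1
  refine Subtype.ext ?_
  change (((coeffGSO S P θ' k (toUnramifiedQuot K P g)) ⟨OMuCarrier.tmul 1 ζ₀, mem_invariants_muTwistO_of_forall S θ' P k hθN hμN _⟩ : _) : OMuCarrier K S (p ^ k)) =
    oMuScalar S (p ^ k) _ (OMuCarrier.tmul 1 ζ₀)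
  rw [show toUnramifiedQuot K P g = (g : GaloisGroupUnramifiedOutside K P) from rfl, quotientInvariants_apply_coe]
  exact SmallImageRttJunctionLocal.muTwistO_eq_oMuScalar S θ' k g _

/-- ★★ **THE ANNIHILATOR OF `[δ_1 ⊗ (1⊗ζ₀)]` IN THE FROBENIUS QUOTIENT `Maps(Γ_K ⧸ U_n, X_k) ⧸ (g − 1)` IS `(p^k, ω_n) + (P)`, `P = (1+T)^x − C(θ′(g)χ_cyc(g))`** — for `κ γ` a unit,
`γ^{x mod pⁿ} g⁻¹ ∈ U_n`, `ζ₀` a generator of `μ_{p^k}` of exact order `p^k`, `θ′|_{N_P} = 1`, `N_P` fixing `μ_{p^k}`. (g26 `smul_mkQ_range_sub_eq_zero_iff` with g27's cyclicity / exact annihilator /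
Frobenius-on-the-generator, and `(1+T)^x ≡ (1+T)^{x mod pⁿ} (mod ω_n)`.) This is the level `(n,k)` of `Ann(u_w) = (P_w)`. [cite: SerreLocalFields1979, XIII §1 Prop. 1] [cite: Washington1997, §13.2]
[cite: Lang1990, Ch. 5 §1] -/
theorem smul_mkQ_coindFrob_single_one_eq_zero_iff (n k : ℕ) {a : ℤ_[p]ˣ} (hγ : (κ γ).toAdd = a) (hθN : ∀ g ∈ ramificationSubgroup K P, θ' g = 1)
    (hμN : ∀ g ∈ ramificationSubgroup K P, ∀ ζ : MuCarrier K (p ^ k), mu K (p ^ k) g ζ = ζ)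
    {e : MuCarrier K (p ^ k) ≃+ ZMod (p ^ k)} {ζ₀ : MuCarrier K (p ^ k)} (he : e ζ₀ = 1) (hζ₀ : ∀ ζ : MuCarrier K (p ^ k), ∃ m : ℤ, ζ = m • ζ₀)
    (hord : ∀ m : ℤ, m • ζ₀ = 0 ↔ ((p ^ k : ℕ) : ℤ) ∣ m)
    {g : absoluteGaloisGroup K} {x : ℤ_[p]} (hx : γ ^ (PadicInt.toZModPow n x).val * g⁻¹ ∈ κ.layerSubgroup n) (f : IwasawaAlgebraO S) :
    (letI := coindModuleΛ S κ γ θ' P n k;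
      f • (LinearMap.range (coindFrob S κ γ θ' P n k g - LinearMap.id)).mkQ
          (coindSingle S κ θ' P n k 1 ⟨OMuCarrier.tmul 1 ζ₀, mem_invariants_muTwistO_of_forall S θ' P k hθN hμN _⟩) = 0) ↔
      f ∈ Ideal.span {PowerSeries.C (((p : ℕ) : padicCoeffIntegers S) ^ k), omegaT S n} ⊔
        Ideal.span {iwasawaToIwasawaO S (PowerSeries.binomialSeries ℤ_[p] x) -
          PowerSeries.C (((θ' g : (padicCoeffIntegers S)ˣ) : padicCoeffIntegers S) * padicIntToCoeffIntegers S ((GaloisRep.cyclotomicCharacter K p g : ℤ_[p]ˣ) : ℤ_[p]))} := by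
  letI := coindModuleΛ S κ γ θ' P n k
  haveI : NeZero (p ^ n) := ⟨pow_ne_zero _ (Fact.out : p.Prime).ne_zero⟩
  have hj : (p ^ n - (PadicInt.toZModPow n x).val) + (PadicInt.toZModPow n x).val = p ^ n := Nat.sub_add_cancel (ZMod.val_lt _).le
  set u : (padicCoeffIntegers S)ˣ := θ' g * Units.map (padicIntToCoeffIntegers S : ℤ_[p] →* padicCoeffIntegers S) (GaloisRep.cyclotomicCharacter K p g) with hu
  have hucoe : (u : padicCoeffIntegers S) = ((θ' g : (padicCoeffIntegers S)ˣ) : padicCoeffIntegers S) * padicIntToCoeffIntegers S ((GaloisRep.cyclotomicCharacter K p g : ℤ_[p]ˣ) : ℤ_[p]) := by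
    rw [hu, Units.val_mul, Units.coe_map]; rfl
  rw [smul_mkQ_range_sub_eq_zero_iff _ (fun b ↦ (exists_smul_single_one_eq S κ γ θ' P n k hγ hθN hμN hζ₀ b).imp fun r hr ↦ hr.symm)
    _ (smul_single_one_eq_zero_iff S κ γ θ' P n k hγ hθN hμN he hord) (coindFrob S κ γ θ' P n k g) _
    (coindFrob_single_one_eq_smul S κ γ θ' P n k hθN hμN ζ₀ hx) f, ← hucoe, sup_span_C_mul_pow_sub_one_eq S n k _ x hj u]

end Frob

end Summit.BirchSwinnertonDyer.BirchSwinnertonDyer.Theorems.SmallImageRttD2Seq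

end
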